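import Literature.MathematicalPhysics.KineticTheory.CollisionTubePullbackStretch
import HarnessLib

/-!
# The collision-cylinder pull-back along hard-sphere orbits, V: one ordered pair

The tube integral over a TRUE stretch is the collision mark times the time integral of the weight over
the actual window (`setIntegral_piece_true`), over any other stretch it is at most `C_χ C_g C_Ψ κε`
times the shell indicator at the stretch end (`abs_setIntegral_piece_fake`); summing over the stretches
of `[0, τ]` gives the pull-back inequality for one ordered pair (`pair_pullback_le`).  Joint
measurability of the tube term and of the weight (`measurable_tubeTerm_uncurry`,
`measurable_weightAt_uncurry`) makes the tube term integrable along good orbits.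

## References

* C. Cercignani, R. Illner, M. Pulvirenti, *The Mathematical Theory of Dilute Gases* (1994), §2.2
  (Boltzmann's collision cylinder: the molecules about to hit a given one within time `dt` fill the
  cylinder of height `|V · n| dt` over the protection sphere; pre-collisional hemisphere `V · n < 0`).
  [CIPDiluteGases1994]
* I. Gallagher, L. Saint-Raymond, B. Texier, *From Newton to Boltzmann* (2013), Part II Ch. 4, §4.1
  (the hard-sphere flow: free flow between collisions, elastic reflection at `|xᵢ − xⱼ| = ε`,
  pre-collisional iff `νⁱʲ · (vᵢ − vⱼ) < 0`; Prop. 4.1.1, Def. 4.1.2). [GallagherSaintRaymondTexier2013]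
-/

noncomputable section

open scoped BigOperators Classical InnerProductSpace ENNReal Topology
open Set MeasureTheory Filter Function
open Literature.Analysis.FluidPDE

namespace Literature.MathematicalPhysics.KineticTheory

/-! ## Joint measurability of the tube term and of the weight -/

attribute [local fun_prop] measurable_torusReprSym_comp measurable_torusDist_comp

section Measurability

variable {σ : ℝ} {N : ℕ} {χ : ℝ × UnitAddTorus (Fin 3) → ℝ} {g : ℝ → ℝ} {Ψ : V3 × V3 × V3 → ℝ}
  {r κ : ℝ}

/-- **Joint measurability of one tube term** in `(t, ζ)`, for continuous `χ, g, Ψ`. [folklore] -/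
theorem measurable_tubeTerm_uncurry (hχ : Continuous χ) (hg : Continuous g) (hΨ : Continuous Ψ)
    (i j : Fin (N + 1)) :
    Measurable fun p : ℝ × Config (N + 1) (Fin 3) T3 => tubeTerm σ N χ g Ψ r κ p.1 p.2 i j := by
  have hχm : Measurable χ := hχ.measurable
  have hgm : Measurable g := hg.measurable
  have hΨm : Measurable Ψ := hΨ.measurable
  dsimp only [tubeTerm, sepAt, relVel, weightAt, hitTime, mollDensity, coneKernel]
  simp only [integral_empiricalMeasure, Torus.geometry_sepVec]
  refine Measurable.ite (measurableSet_tubePredicate _ ?_ ?_ ?_ ?_ ?_ ?_ ?_ ?_) ?_ measurable_const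
  all_goals fun_prop

/-- Joint measurability of the weight `χ(t, xᵢ) g(σ³ρ_r(xᵢ))` in `(t, ζ)`. [folklore] -/
theorem measurable_weightAt_uncurry (hχ : Continuous χ) (hg : Continuous g) (i : Fin (N + 1)) :
    Measurable fun p : ℝ × Config (N + 1) (Fin 3) T3 => weightAt σ N χ g r p.1 p.2 i := by
  have hχm : Measurable χ := hχ.measurable
  have hgm : Measurable g := hg.measurable
  dsimp only [weightAt, mollDensity, coneKernel]
  simp only [integral_empiricalMeasure]
  fun_prop

end Measurability

/-! ## The tube integral over one stretch -/

section PieceIntegrals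

variable {σ : ℝ} {N : ℕ} {Φ : HardSphereFlow (Torus.geometry (Fin 3)) (hsDiameter σ N) (N + 1)}
  {z : Config (N + 1) (Fin 3) T3} {χ : ℝ × UnitAddTorus (Fin 3) → ℝ} {g : ℝ → ℝ}
  {Ψ : V3 × V3 × V3 → ℝ} {r κ L : ℝ}

/-- **The tube integral over a TRUE stretch** `(a, b]` (`b` a collision of `(i, j)`, flights of
`i, j` free on `(a, b)`) is the collision mark at `b` times the time integral of the weight `χ g`
over the window `(a, b) ∩ [b − κ ε, ∞)`. [folklore] -/
theorem setIntegral_piece_true (hz : z ∈ Φ.good) {i j : Fin (N + 1)} {a b : ℝ} (hab : a < b)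
    (hi : ∀ u ∈ Ioo a b, ¬ Participates (Torus.geometry (Fin 3)) (hsDiameter σ N) (orbit σ N Φ z u) i)
    (hj : ∀ u ∈ Ioo a b, ¬ Participates (Torus.geometry (Fin 3)) (hsDiameter σ N) (orbit σ N Φ z u) j)
    (hp : (i, j) ∈ contactPairs (Torus.geometry (Fin 3)) (hsDiameter σ N) (orbit σ N Φ z b))
    (hε : 0 < hsDiameter σ N) (hκ : 0 ≤ κ) (hL : 0 ≤ L)
    (hsmall : hsDiameter σ N * (1 + 2 * L * κ) < 1 / 2)
    (hΨ0 : ∀ n v w : V3, 2 * L ≤ ‖w - v‖ → Ψ (n, v, w) = 0) :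
    ∫ t in Ioc a b, tubeTerm σ N χ g Ψ r κ t (orbit σ N Φ z t) i j =
      collMark σ N Ψ (orbit σ N Φ z b) i j *
        ∫ t in Ioo a b ∩ Ici (b - κ * hsDiameter σ N), weightAt σ N χ g r t (orbit σ N Φ z t) i := by
  rw [integral_Ioc_eq_integral_Ioo]
  have hcongr : EqOn (fun t => tubeTerm σ N χ g Ψ r κ t (orbit σ N Φ z t) i j)
      ((Ici (b - κ * hsDiameter σ N)).indicator fun t =>
        weightAt σ N χ g r t (orbit σ N Φ z t) i * collMark σ N Ψ (orbit σ N Φ z b) i j) (Ioo a b) := by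
    intro t ht
    dsimp only
    rw [tubeTerm_orbit_eq_of_collision hz hab hi hj hp hε hκ hL hsmall hΨ0 ht, Set.indicator_apply]
    simp only [mem_Ici]
  rw [setIntegral_congr_fun measurableSet_Ioo hcongr, setIntegral_indicator measurableSet_Ici,
    integral_mul_const, mul_comm]

/-- Nonnegativity of the sup-bound constants from the bound hypotheses. [folklore] -/
theorem consts_nonneg {τ Cχ Cg CΨ : ℝ} (hτ : 0 ≤ τ) (hχb : ∀ t ∈ Icc (0 : ℝ) τ, ∀ x, |χ (t, x)| ≤ Cχ)
    (hgb : ∀ a, 0 ≤ a → |g a| ≤ Cg) (hΨb : ∀ p, |Ψ p| ≤ CΨ) : 0 ≤ Cχ ∧ 0 ≤ Cg ∧ 0 ≤ CΨ :=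
  ⟨(abs_nonneg _).trans (hχb 0 ⟨le_rfl, hτ⟩ 0), (abs_nonneg _).trans (hgb 0 le_rfl),
    (abs_nonneg _).trans (hΨb 0)⟩

/-- **The tube integral over a stretch NOT ending at a collision of the pair** is bounded by
`C_χ C_g C_Ψ · κ ε` if the pair sits in the near-contact shell at the end `b` of the stretch, and
vanishes otherwise. [folklore] -/
theorem abs_setIntegral_piece_fake (hz : z ∈ Φ.good) {i j : Fin (N + 1)} (hij : i ≠ j) {a b : ℝ}
    (hab : a < b)
    (hi : ∀ u ∈ Ioo a b, ¬ Participates (Torus.geometry (Fin 3)) (hsDiameter σ N) (orbit σ N Φ z u) i)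
    (hj : ∀ u ∈ Ioo a b, ¬ Participates (Torus.geometry (Fin 3)) (hsDiameter σ N) (orbit σ N Φ z u) j)
    (hp : (i, j) ∉ contactPairs (Torus.geometry (Fin 3)) (hsDiameter σ N) (orbit σ N Φ z b))
    (hε : 0 < hsDiameter σ N) (hκ : 0 ≤ κ) (hL : 0 ≤ L)
    (hsmall : hsDiameter σ N * (1 + 2 * L * κ) < 1 / 2)
    (hΨ0 : ∀ n v w : V3, 2 * L ≤ ‖w - v‖ → Ψ (n, v, w) = 0)
    {τ Cχ Cg CΨ : ℝ} (hχb : ∀ t ∈ Icc (0 : ℝ) τ, ∀ x, |χ (t, x)| ≤ Cχ)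
    (hgb : ∀ a, 0 ≤ a → |g a| ≤ Cg) (hΨb : ∀ p, |Ψ p| ≤ CΨ) (hσ : 0 ≤ σ) (hr : 0 < r)
    (ha0 : 0 ≤ a) (hbτ : b ≤ τ) :
    |∫ t in Ioc a b, tubeTerm σ N χ g Ψ r κ t (orbit σ N Φ z t) i j| ≤
      Cχ * Cg * CΨ * (κ * hsDiameter σ N) *
        (if hsDiameter σ N < ‖sepAt (orbit σ N Φ z b) i j‖ ∧
            ‖sepAt (orbit σ N Φ z b) i j‖ ≤ hsDiameter σ N * (1 + 2 * L * κ) then 1 else 0) := by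
  obtain ⟨hCχ, hCg, hCΨ⟩ := consts_nonneg (ha0.trans (hab.le.trans hbτ)) hχb hgb hΨb
  have hεκ : 0 ≤ κ * hsDiameter σ N := mul_nonneg hκ hε.le
  rw [integral_Ioc_eq_integral_Ioo]
  by_cases hex : ∃ t ∈ Ioo a b, tubeTerm σ N χ g Ψ r κ t (orbit σ N Φ z t) i j ≠ 0
  · obtain ⟨t₀, ht₀, hne⟩ := hex
    obtain ⟨-, hsh1, hsh2⟩ := tubeTerm_orbit_fake hz hij hab hi hj hp hε hκ hL hsmall hΨ0 ht₀ hne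
    rw [if_pos ⟨hsh1, hsh2⟩, mul_one]
    have hcongr : EqOn (fun t => tubeTerm σ N χ g Ψ r κ t (orbit σ N Φ z t) i j)
        ((Ioi (b - κ * hsDiameter σ N)).indicator fun t => tubeTerm σ N χ g Ψ r κ t (orbit σ N Φ z t) i j)
        (Ioo a b) := by
      intro t ht
      dsimp only
      by_cases h0 : tubeTerm σ N χ g Ψ r κ t (orbit σ N Φ z t) i j = 0
      · simp only [Set.indicator_apply, h0, ite_self]
      · rw [Set.indicator_of_mem]
        exact (tubeTerm_orbit_fake hz hij hab hi hj hp hε hκ hL hsmall hΨ0 ht h0).1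
    rw [setIntegral_congr_fun measurableSet_Ioo hcongr, setIntegral_indicator measurableSet_Ioi]
    have hvol : volume (Ioo a b ∩ Ioi (b - κ * hsDiameter σ N)) < ⊤ :=
      (measure_mono inter_subset_left).trans_lt measure_Ioo_lt_top
    have hbound := norm_setIntegral_le_of_norm_le_const hvol
      (f := fun t => tubeTerm σ N χ g Ψ r κ t (orbit σ N Φ z t) i j) (C := Cχ * Cg * CΨ)
      (fun t ht => by
        rw [Real.norm_eq_abs]
        exact abs_tubeTerm_le hχb hgb hΨb hσ hr ⟨ha0.trans ht.1.1.le, ht.1.2.le.trans hbτ⟩ _ i j)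
    rw [Real.norm_eq_abs] at hbound
    refine hbound.trans (mul_le_mul_of_nonneg_left ?_ (by positivity))
    calc volume.real (Ioo a b ∩ Ioi (b - κ * hsDiameter σ N))
        ≤ volume.real (Ioo (b - κ * hsDiameter σ N) b) :=
          measureReal_mono (fun t ht => ⟨ht.2, ht.1.2⟩) measure_Ioo_lt_top.ne
      _ = κ * hsDiameter σ N := by rw [Real.volume_real_Ioo_of_le (by linarith)]; ring
  · have hex' : EqOn (fun t => tubeTerm σ N χ g Ψ r κ t (orbit σ N Φ z t) i j) (fun _ => 0) (Ioo a b) :=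
      fun t ht => by_contra fun h => hex ⟨t, ht, h⟩
    rw [setIntegral_congr_fun measurableSet_Ioo hex', integral_zero, abs_zero]
    positivity

end PieceIntegrals

/-! ## The pull-back for one ordered pair -/

section PairPullback

variable {σ : ℝ} {N : ℕ} {Φ : HardSphereFlow (Torus.geometry (Fin 3)) (hsDiameter σ N) (N + 1)}
  {z : Config (N + 1) (Fin 3) T3} {χ : ℝ × UnitAddTorus (Fin 3) → ℝ} {g : ℝ → ℝ}
  {Ψ : V3 × V3 × V3 → ℝ} {r κ L τ Cχ Cg CΨ : ℝ}

/-- The tube term along a good orbit is integrable on `[0, τ]` (bounded and measurable). [folklore] -/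
theorem integrableOn_tubeTerm_orbit (hz : z ∈ Φ.good) (hχ : Continuous χ) (hg : Continuous g)
    (hΨc : Continuous Ψ) (hχb : ∀ t ∈ Icc (0 : ℝ) τ, ∀ x, |χ (t, x)| ≤ Cχ)
    (hgb : ∀ a, 0 ≤ a → |g a| ≤ Cg) (hΨb : ∀ p, |Ψ p| ≤ CΨ) (hσ : 0 ≤ σ) (hr : 0 < r)
    (i j : Fin (N + 1)) :
    IntegrableOn (fun t => tubeTerm σ N χ g Ψ r κ t (orbit σ N Φ z t) i j) (Icc 0 τ) := by
  have h1 := measurable_tubeTerm_uncurry (σ := σ) (r := r) (κ := κ) hχ hg hΨc i j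
  have h2 : Measurable fun t : ℝ => (t, orbit σ N Φ z t) := measurable_id.prodMk (measurable_orbit hz)
  have hmeas : Measurable fun t => tubeTerm σ N χ g Ψ r κ t (orbit σ N Φ z t) i j := by
    exact Measurable.comp (g := fun p : ℝ × Config (N + 1) (Fin 3) T3 => tubeTerm σ N χ g Ψ r κ p.1 p.2 i j)
      (f := fun t : ℝ => (t, orbit σ N Φ z t)) h1 h2
  refine IntegrableOn.of_bound measure_Icc_lt_top hmeas.aestronglyMeasurable (Cχ * Cg * CΨ) ?_
  refine ae_restrict_of_forall_mem measurableSet_Icc fun t ht => ?_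
  rw [Real.norm_eq_abs]
  exact abs_tubeTerm_le hχb hgb hΨb hσ hr ht _ i j

/-- **The cylinder pull-back for one ordered pair `(i, j)` along a good orbit.**  `κ ε` times the
collision marks of `(i, j)` in `[0, τ]` minus the time integral of the tube term of `(i, j)` over
`[0, τ]` is bounded by the collision-side mismatch of the pair plus `C_χ C_g C_Ψ κ ε` times the
number of stretch ends `b` (participation times of `i` or `j` in `(0, τ]`, or `τ`) at which the pair
sits in the near-contact shell. [folklore] -/
theorem pair_pullback_le (hz : z ∈ Φ.good) (hσ : 0 < σ) (hκ : 0 < κ) (hL : 0 ≤ L)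
    (hsmall : hsDiameter σ N * (1 + 2 * L * κ) < 1 / 2) (hτ : 0 < τ) (hr : 0 < r)
    (hχ : Continuous χ) (hg : Continuous g) (hΨc : Continuous Ψ)
    (hχb : ∀ t ∈ Icc (0 : ℝ) τ, ∀ x, |χ (t, x)| ≤ Cχ) (hgb : ∀ a, 0 ≤ a → |g a| ≤ Cg)
    (hΨb : ∀ p, |Ψ p| ≤ CΨ) (hΨ0 : ∀ n v w : V3, 2 * L ≤ ‖w - v‖ → Ψ (n, v, w) = 0)
    (i j : Fin (N + 1)) :
    |κ * hsDiameter σ N * ∑ s ∈ ((isTraj hz).locFinite 0 τ).toFinset,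
        (if (i, j) ∈ contactPairs (Torus.geometry (Fin 3)) (hsDiameter σ N) (orbit σ N Φ z s) then
          weightAt σ N χ g r s (orbit σ N Φ z s) i * collMark σ N Ψ (orbit σ N Φ z s) i j else 0) -
      ∫ t in Icc 0 τ, tubeTerm σ N χ g Ψ r κ t (orbit σ N Φ z t) i j| ≤
    (∑ s ∈ ((isTraj hz).locFinite 0 τ).toFinset,
        if (i, j) ∈ contactPairs (Torus.geometry (Fin 3)) (hsDiameter σ N) (orbit σ N Φ z s) then
          |collMark σ N Ψ (orbit σ N Φ z s) i j| *
            |κ * hsDiameter σ N * weightAt σ N χ g r s (orbit σ N Φ z s) i -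
              ∫ t in Ioo (pairFlightStart σ N Φ z i j s) s ∩ Ici (s - κ * hsDiameter σ N),
                weightAt σ N χ g r t (orbit σ N Φ z t) i|
        else 0) +
      Cχ * Cg * CΨ * (κ * hsDiameter σ N) *
        ((∑ b ∈ ((isTraj hz).finite_collisionTimes_inter_of_subset_Icc (S := Ioc 0 τ) Ioc_subset_Icc_self).toFinset,
            if Participates (Torus.geometry (Fin 3)) (hsDiameter σ N) (orbit σ N Φ z b) i ∨
                Participates (Torus.geometry (Fin 3)) (hsDiameter σ N) (orbit σ N Φ z b) j then
              shellInd σ N L κ (orbit σ N Φ z b) i j else 0) +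
          shellInd σ N L κ (orbit σ N Φ z τ) i j) := by
  have hε : 0 < hsDiameter σ N := hsDiameter_pos hσ N
  have hεκ : 0 ≤ κ * hsDiameter σ N := mul_nonneg hκ.le hε.le
  obtain ⟨hCχ, hCg, hCΨ⟩ := consts_nonneg hτ.le hχb hgb hΨb
  set Call := ((isTraj hz).locFinite 0 τ).toFinset with hCall
  set Cpos := ((isTraj hz).finite_collisionTimes_inter_of_subset_Icc (S := Ioc 0 τ) Ioc_subset_Icc_self).toFinset
    with hCpos
  have hmemCall : ∀ s, s ∈ Call ↔ s ∈ collisionTimes (Torus.geometry (Fin 3)) (hsDiameter σ N) (orbit σ N Φ z) ∧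
      s ∈ Icc 0 τ := fun s => by rw [hCall, Set.Finite.mem_toFinset]; rfl
  have hmemCpos : ∀ s, s ∈ Cpos ↔ s ∈ collisionTimes (Torus.geometry (Fin 3)) (hsDiameter σ N) (orbit σ N Φ z) ∧
      s ∈ Ioc 0 τ := fun s => by rw [hCpos, Set.Finite.mem_toFinset]; rfl
  -- nonnegativity of the right-hand side pieces
  have hR1 : 0 ≤ ∑ s ∈ Call,
      (if (i, j) ∈ contactPairs (Torus.geometry (Fin 3)) (hsDiameter σ N) (orbit σ N Φ z s) then
        |collMark σ N Ψ (orbit σ N Φ z s) i j| *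
          |κ * hsDiameter σ N * weightAt σ N χ g r s (orbit σ N Φ z s) i -
            ∫ t in Ioo (pairFlightStart σ N Φ z i j s) s ∩ Ici (s - κ * hsDiameter σ N),
              weightAt σ N χ g r t (orbit σ N Φ z t) i|
      else 0) :=
    Finset.sum_nonneg fun s _ => by split_ifs <;> positivity
  have hR2 : 0 ≤ (∑ b ∈ Cpos,
      if Participates (Torus.geometry (Fin 3)) (hsDiameter σ N) (orbit σ N Φ z b) i ∨
          Participates (Torus.geometry (Fin 3)) (hsDiameter σ N) (orbit σ N Φ z b) j then
        shellInd σ N L κ (orbit σ N Φ z b) i j else 0) + shellInd σ N L κ (orbit σ N Φ z τ) i j :=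
    add_nonneg (Finset.sum_nonneg fun b _ => by split_ifs; exacts [shellInd_nonneg _ _ _ _ _, le_rfl])
      (shellInd_nonneg _ _ _ _ _)
  -- the diagonal pair contributes nothing
  by_cases hij : i = j
  · subst hij
    have hno : ∀ s, (i, i) ∉ contactPairs (Torus.geometry (Fin 3)) (hsDiameter σ N) (orbit σ N Φ z s) :=
      fun s h => (mem_contactPairs.1 h).1 rfl
    have hzero : ∀ t, tubeTerm σ N χ g Ψ r κ t (orbit σ N Φ z t) i i = 0 := fun t => by
      rw [tubeTerm_eq_ite, if_neg]; exact fun h => h.1 rfl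
    simp only [hno, if_false, Finset.sum_const_zero, mul_zero, hzero, integral_zero, sub_zero, abs_zero]
    positivity
  -- the break points of the pair
  set T : Finset ℝ := insert 0 (insert τ (Call.filter fun s =>
    Participates (Torus.geometry (Fin 3)) (hsDiameter σ N) (orbit σ N Φ z s) i ∨
      Participates (Torus.geometry (Fin 3)) (hsDiameter σ N) (orbit σ N Φ z s) j)) with hTdef
  have hTmem : ∀ s, s ∈ T ↔ s = 0 ∨ s = τ ∨ (s ∈ Icc 0 τ ∧
      (Participates (Torus.geometry (Fin 3)) (hsDiameter σ N) (orbit σ N Φ z s) i ∨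
        Participates (Torus.geometry (Fin 3)) (hsDiameter σ N) (orbit σ N Φ z s) j)) := by
    intro s
    rw [hTdef, Finset.mem_insert, Finset.mem_insert, Finset.mem_filter, hmemCall]
    constructor
    · rintro (h | h | ⟨⟨-, hI⟩, hP⟩)
      · exact Or.inl h
      · exact Or.inr (Or.inl h)
      · exact Or.inr (Or.inr ⟨hI, hP⟩)
    · rintro (h | h | ⟨hI, hP⟩)
      · exact Or.inl h
      · exact Or.inr (Or.inl h)
      · refine Or.inr (Or.inr ⟨⟨?_, hI⟩, hP⟩)
        rcases hP with hP | hP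
        · exact collisionTimesOf_subset _ i hP
        · exact collisionTimesOf_subset _ j hP
  obtain ⟨h1, h2, h3, h4, h5, h6⟩ := pairPieces_hyps hz hτ.le hTmem
  have hfI := integrableOn_tubeTerm_orbit (κ := κ) (τ := τ) hz hχ hg hΨc hχb hgb hΨb hσ.le hr i j
  have hsplit := setIntegral_Icc_eq_sum_pieces h1 h2 h3 h4 h5 h6 hfI
  -- freeness of the flights on each stretch
  have hfree : ∀ b, ∀ u ∈ Ioo (pairFlightStart σ N Φ z i j b) b,
      ¬ Participates (Torus.geometry (Fin 3)) (hsDiameter σ N) (orbit σ N Φ z u) i ∧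
        ¬ Participates (Torus.geometry (Fin 3)) (hsDiameter σ N) (orbit σ N Φ z u) j :=
    fun b u hu => not_participates_of_mem_Ioo_pairFlightStart hz i j hu
  -- TRUE stretches: the exact value
  have htrue : ∀ b ∈ T.filter (fun b => (i, j) ∈ contactPairs (Torus.geometry (Fin 3)) (hsDiameter σ N) (orbit σ N Φ z b)),
      ∫ t in Ioc (pairFlightStart σ N Φ z i j b) b, tubeTerm σ N χ g Ψ r κ t (orbit σ N Φ z t) i j =
        collMark σ N Ψ (orbit σ N Φ z b) i j *
          ∫ t in Ioo (pairFlightStart σ N Φ z i j b) b ∩ Ici (b - κ * hsDiameter σ N),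
            weightAt σ N χ g r t (orbit σ N Φ z t) i := by
    intro b hb
    obtain ⟨hbT, hp⟩ := Finset.mem_filter.1 hb
    rcases (h2 b hbT).1.lt_or_eq with hb0 | hb0
    · exact setIntegral_piece_true hz (h4 b hbT hb0) (fun u hu => (hfree b u hu).1) (fun u hu => (hfree b u hu).2)
        hp hε hκ.le hL hsmall hΨ0
    · -- `b = 0`: both windows are empty
      rw [← hb0]
      have hI1 : Ioc (pairFlightStart σ N Φ z i j 0) 0 = ∅ := Ioc_eq_empty (not_lt.2 (h3 0 (hb0 ▸ hbT)))
      have hI2 : Ioo (pairFlightStart σ N Φ z i j 0) 0 ∩ Ici (0 - κ * hsDiameter σ N) = ∅ := by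
        rw [Ioo_eq_empty (not_lt.2 (h3 0 (hb0 ▸ hbT))), empty_inter]
      rw [hI1, hI2, Measure.restrict_empty, integral_zero_measure, integral_zero_measure, mul_zero]
  -- the TRUE break points are exactly the collision times of the pair in `[0, τ]`
  have hfilter : T.filter (fun b => (i, j) ∈ contactPairs (Torus.geometry (Fin 3)) (hsDiameter σ N) (orbit σ N Φ z b)) =
      Call.filter (fun s => (i, j) ∈ contactPairs (Torus.geometry (Fin 3)) (hsDiameter σ N) (orbit σ N Φ z s)) := by
    ext s
    rw [Finset.mem_filter, Finset.mem_filter, hmemCall]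
    constructor
    · rintro ⟨hsT, hp⟩
      exact ⟨⟨mem_collisionTimes_of_mem_contactPairs hp, (h2 s hsT).1, (h2 s hsT).2⟩, hp⟩
    · rintro ⟨⟨-, hI⟩, hp⟩
      exact ⟨(hTmem s).2 (Or.inr (Or.inr ⟨hI, Or.inl ⟨j, Or.inl hp⟩⟩)), hp⟩
  -- OTHER stretches: the bound
  have hfake : ∀ b ∈ T.filter (fun b => (i, j) ∉ contactPairs (Torus.geometry (Fin 3)) (hsDiameter σ N) (orbit σ N Φ z b)),
      |∫ t in Ioc (pairFlightStart σ N Φ z i j b) b, tubeTerm σ N χ g Ψ r κ t (orbit σ N Φ z t) i j| ≤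
        Cχ * Cg * CΨ * (κ * hsDiameter σ N) * (if 0 < b then shellInd σ N L κ (orbit σ N Φ z b) i j else 0) := by
    intro b hb
    obtain ⟨hbT, hp⟩ := Finset.mem_filter.1 hb
    rcases (h2 b hbT).1.lt_or_eq with hb0 | hb0
    · rw [if_pos hb0]
      exact abs_setIntegral_piece_fake hz hij (h4 b hbT hb0) (fun u hu => (hfree b u hu).1)
        (fun u hu => (hfree b u hu).2) hp hε hκ.le hL hsmall hΨ0 hχb hgb hΨb hσ.le hr (h3 b hbT) (h2 b hbT).2
    · rw [← hb0, Ioc_eq_empty (not_lt.2 (h3 0 (hb0 ▸ hbT))), Measure.restrict_empty, integral_zero_measure,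
        abs_zero, if_neg (lt_irrefl 0), mul_zero]
  -- assemble
  rw [hsplit, ← Finset.sum_filter_add_sum_filter_not T
    (fun b => (i, j) ∈ contactPairs (Torus.geometry (Fin 3)) (hsDiameter σ N) (orbit σ N Φ z b)),
    Finset.sum_congr rfl htrue, hfilter, Finset.sum_filter, Finset.mul_sum]
  have hcomb : ∀ s ∈ Call,
      κ * hsDiameter σ N *
          (if (i, j) ∈ contactPairs (Torus.geometry (Fin 3)) (hsDiameter σ N) (orbit σ N Φ z s) then
            weightAt σ N χ g r s (orbit σ N Φ z s) i * collMark σ N Ψ (orbit σ N Φ z s) i j else 0) -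
        (if (i, j) ∈ contactPairs (Torus.geometry (Fin 3)) (hsDiameter σ N) (orbit σ N Φ z s) then
            collMark σ N Ψ (orbit σ N Φ z s) i j *
              ∫ t in Ioo (pairFlightStart σ N Φ z i j s) s ∩ Ici (s - κ * hsDiameter σ N),
                weightAt σ N χ g r t (orbit σ N Φ z t) i else 0) =
      if (i, j) ∈ contactPairs (Torus.geometry (Fin 3)) (hsDiameter σ N) (orbit σ N Φ z s) then
        collMark σ N Ψ (orbit σ N Φ z s) i j *
          (κ * hsDiameter σ N * weightAt σ N χ g r s (orbit σ N Φ z s) i -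
            ∫ t in Ioo (pairFlightStart σ N Φ z i j s) s ∩ Ici (s - κ * hsDiameter σ N),
              weightAt σ N χ g r t (orbit σ N Φ z t) i) else 0 := by
    intro s _
    split_ifs <;> ring
  rw [show ∀ a b c : ℝ, a - (b + c) = (a - b) - c from fun a b c => by ring, ← Finset.sum_sub_distrib,
    Finset.sum_congr rfl hcomb]
  refine (abs_sub _ _).trans (add_le_add ?_ ?_)
  · refine (Finset.abs_sum_le_sum_abs _ _).trans (Finset.sum_le_sum fun s _ => ?_)
    split_ifs
    · rw [abs_mul]
    · rw [abs_zero]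
  · refine (Finset.abs_sum_le_sum_abs _ _).trans ?_
    refine (Finset.sum_le_sum hfake).trans ?_
    rw [← Finset.mul_sum]
    refine mul_le_mul_of_nonneg_left ?_ (by positivity)
    rw [← Finset.sum_filter]
    -- the positive non-TRUE break points are `τ` or participation times in `(0, τ]`
    have hsub : (T.filter fun b => (i, j) ∉ contactPairs (Torus.geometry (Fin 3)) (hsDiameter σ N) (orbit σ N Φ z b)).filter
        (fun b => 0 < b) ⊆ insert τ (Cpos.filter fun b =>
          Participates (Torus.geometry (Fin 3)) (hsDiameter σ N) (orbit σ N Φ z b) i ∨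
            Participates (Torus.geometry (Fin 3)) (hsDiameter σ N) (orbit σ N Φ z b) j) := by
      intro b hb
      rw [Finset.mem_filter, Finset.mem_filter] at hb
      obtain ⟨⟨hbT, -⟩, hb0⟩ := hb
      rw [Finset.mem_insert, Finset.mem_filter, hmemCpos]
      rcases (hTmem b).1 hbT with rfl | rfl | ⟨hI, hP⟩
      · exact absurd hb0 (lt_irrefl 0)
      · exact Or.inl rfl
      · refine Or.inr ⟨⟨?_, hb0, hI.2⟩, hP⟩
        rcases hP with hP | hP
        · exact collisionTimesOf_subset _ i hP
        · exact collisionTimesOf_subset _ j hP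
    refine (Finset.sum_le_sum_of_subset_of_nonneg hsub fun b _ _ => shellInd_nonneg _ _ _ _ _).trans ?_
    rw [← Finset.sum_filter]
    by_cases hτmem : τ ∈ Cpos.filter fun b =>
        Participates (Torus.geometry (Fin 3)) (hsDiameter σ N) (orbit σ N Φ z b) i ∨
          Participates (Torus.geometry (Fin 3)) (hsDiameter σ N) (orbit σ N Φ z b) j
    · rw [Finset.insert_eq_of_mem hτmem]
      exact le_add_of_nonneg_right (shellInd_nonneg _ _ _ _ _)
    · rw [Finset.sum_insert hτmem, add_comm]

end PairPullback

end Literature.MathematicalPhysics.KineticTheory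

end
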